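import Summits.NavierStokesRegularity.NavierStokesRegularity.Theses.ScaledTopAlignment
import Summits.NavierStokesRegularity.NavierStokesRegularity.Theorems.ScaledTopAlignmentSeqNearMaxGlueKit
import HarnessLib

/-!
# Route `ScaledTopAlignment`: the deciding crux W3ᵐᵗ (stmt-NavierStokesRegularity-19551) IMPLIES the
# SEQUENCE door, BY NAME — and the sequence door plus NoTypeII still gives Clay (A)

Dominance edge for the planner (T1 strength of the filed crux vs the weakest gluable member of the family,
`ScaledTopAlignmentSeqNearMaxGlueKit`): a time set of final density `≤ θ < 1` at `T` misses points in every
short final interval (`exists_not_mem_of_finalDensity_lt_one`), so W3ᵐᵗ's exceptional-set form yields, for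
all parameters, a sequence of good times `t_j → T` (`seqNearMaxBulkAlignment_of_aprioriMostTimesBulkAlignment`,
the relative near-maximum premise being simply dropped); composing with the kit:
`navierStokesRegularity_of_aprioriMostTimesBulkAlignment_via_seq` (same conclusion as the route's `closes`,
through the weaker door). WHAT THIS IS NOT: not NS regularity; implications between OPEN statements. [folklore]
-/

noncomputable section
-- the summit and its single sub-problem share the name (CONVENTIONS §1), as in every Theorems file
set_option linter.dupNamespace false
open MeasureTheory Set Filter Topology
open Literature.Analysis Literature.Analysis.FluidPDE

namespace Summit.NavierStokesRegularity.NavierStokesRegularity.Theorems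

/-- A time set of final density `≤ θ < 1` at `T` (`volume (E ∩ (T−h,T)) ≤ θ h` for `0 < h < h₀`) misses a
point of every final interval `(T − h, T)`, `0 < h < h₀`. [folklore] -/
theorem exists_not_mem_of_finalDensity_lt_one {T θ h0 : ℝ} {E : Set ℝ} (hθ : θ < 1)
    (hE : ∀ h : ℝ, 0 < h → h < h0 → volume (E ∩ Ioo (T - h) T) ≤ ENNReal.ofReal (θ * h))
    {h : ℝ} (hh : 0 < h) (hh0 : h < h0) : ∃ t ∈ Ioo (T - h) T, t ∉ E := by
  by_contra hno
  push Not at hno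
  have hsub : Ioo (T - h) T ⊆ E ∩ Ioo (T - h) T := fun t ht => ⟨hno t ht, ht⟩
  have hvol : volume (Ioo (T - h) T) = ENNReal.ofReal h := by rw [Real.volume_Ioo]; congr 1; ring
  have hle : ENNReal.ofReal h ≤ ENNReal.ofReal (θ * h) := by
    rw [← hvol]; exact (measure_mono hsub).trans (hE h hh hh0)
  have hlt : θ * h < h := by nlinarith
  exact absurd hle (not_le.2 ((ENNReal.ofReal_lt_ofReal_iff hh).2 hlt))

/-- **W3ᵐᵗ ⇒ the sequence door, BY NAME** (stmt-19551 ⇒ the hypothesis of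
`navierStokesRegularity_of_seqNearMaxBulkAlignment_of_noTypeII`): outside a set of final density `< 1` there are
good times arbitrarily close to `T`; the relative near-maximum premise is dropped. [folklore] -/
theorem seqNearMaxBulkAlignment_of_aprioriMostTimesBulkAlignment
    (hW : Summit.NavierStokesRegularity.NavierStokesRegularity.Theses.ScaledTopAlignment.AprioriMostTimesBulkAlignment) :
    ∀ (ν T : ℝ), 0 < ν → 0 < T → ∀ (u : ℝ → EuclideanSpace ℝ (Fin 3) → EuclideanSpace ℝ (Fin 3)) (p : ℝ → EuclideanSpace ℝ (Fin 3) → ℝ), Literature.Analysis.FluidPDE.IsClassicalNSSolutionOn (Set.Ico 0 T) ν 0 u p → Literature.Analysis.FluidPDE.IsLerayHopfOn T ν 0 (u 0) u → Literature.Analysis.FluidPDE.HasRapidSpatialDecay (u 0) → ∃ lam0 : ℝ, lam0 < 1 ∧ ∃ R0 : ℝ, 0 < R0 ∧ ∀ κ : ℝ, 0 < κ → ∀ q : ℝ, 0 < q → ∀ ε : ℝ, 0 < ε → ∀ δ : ℝ, 0 < δ → ∃ M : ℝ, 0 < M ∧ ∃ ts : ℕ → ℝ, (∀ j, ts j ∈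 Set.Ico 0 T) ∧ Filter.Tendsto ts Filter.atTop (nhds T) ∧ ∀ (j : ℕ) (x : EuclideanSpace ℝ (Fin 3)), M ≤ ‖Literature.Analysis.FluidPDE.curl (u (ts j)) x‖ → κ / (T - ts j) ≤ ‖Literature.Analysis.FluidPDE.curl (u (ts j)) x‖ → (∀ x' : EuclideanSpace ℝ (Fin 3), q * ‖Literature.Analysis.FluidPDE.curl (u (ts j)) x'‖ ≤ ‖Literature.Analysis.FluidPDE.curl (u (ts j)) x‖) → MeasureTheory.volume {y : EuclideanSpace ℝ (Fin 3) | lam0 * ‖Literature.Analysis.FluidPDE.curl (u (ts j)) x‖ ≤ ‖Literature.Analysis.FluidPDE.curl (u (ts j)) y‖ ∧ ‖x - y‖ ≤ R0 * Real.sqrt (ν / ‖Literature.Analysis.FluidPDE.curl (u (ts j)) x‖) ∧ ε < Real.sqrt (1 - (inner ℝ (‖Literature.Analysis.FluidPDE.curl (u (ts j)) x‖⁻¹ • Literature.Analysis.FluidPDE.curl (u (ts j)) x) (‖Literature.Analysis.FluidPDE.curl (u (ts j)) y‖⁻¹ • Literature.Analysis.FluidPDE.curl (u (ts j)) y)) ^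 2)} ≤ ENNReal.ofReal (δ * Real.sqrt (ν / ‖Literature.Analysis.FluidPDE.curl (u (ts j)) x‖) ^ 3) := by
  intro ν T hν hT u p hcl hLH hdec
  obtain ⟨lam0, hlam0, R0, hR0, θ, hθ, hfam⟩ := hW ν T hν hT u p hcl hLH hdec
  refine ⟨lam0, hlam0, R0, hR0, fun κ hκ q _hq ε hε δ hδ => ?_⟩
  obtain ⟨M, hM, E, ⟨h0, hh0, hE⟩, hgood⟩ := hfam κ hκ ε hε δ hδ
  -- good times in the final intervals of length `h_j = min h0 T / (j + 2)`
  set hh : ℕ → ℝ := fun j => min h0 T / ((j : ℝ) + 2) with hhdef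
  have hmin : 0 < min h0 T := lt_min hh0 hT
  have hhpos : ∀ j, 0 < hh j := fun j => by rw [hhdef]; positivity
  have hhlt : ∀ j, hh j < min h0 T := fun j => by
    rw [hhdef, div_lt_iff₀ (by positivity)]; nlinarith [(Nat.cast_nonneg j : (0 : ℝ) ≤ j)]
  have hsel : ∀ j, ∃ t ∈ Ioo (T - hh j) T, t ∉ E := fun j =>
    exists_not_mem_of_finalDensity_lt_one (T := T) hθ hE (hhpos j) ((hhlt j).trans_le (min_le_left _ _))
  choose ts hts htsE using hsel
  have htsI : ∀ j, ts j ∈ Ico 0 T := fun j =>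
    ⟨by linarith [(hts j).1, (hhlt j).trans_le (min_le_right h0 T)], (hts j).2⟩
  refine ⟨M, hM, ts, htsI, ?_, fun j x hMx hκx _ => hgood (ts j) (htsI j) (htsE j) x hMx hκx⟩
  -- `ts → T`
  have hh0' : Tendsto hh atTop (𝓝 0) := by
    have h := (tendsto_one_div_add_atTop_nhds_zero_nat (𝕜 := ℝ)).comp (tendsto_add_atTop_nat 1)
    have h' : Tendsto (fun j : ℕ => min h0 T * (1 / ((j : ℝ) + 2))) atTop (𝓝 (min h0 T * 0)) := by
      refine (h.congr fun j => ?_).const_mul _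
      simp only [Function.comp_apply, Nat.cast_add, Nat.cast_one]
      ring
    rw [mul_zero] at h'
    exact h'.congr fun j => by rw [hhdef]; ring
  have hlow : Tendsto (fun j => T - hh j) atTop (𝓝 T) := by
    have h := hh0'.const_sub T
    rwa [sub_zero] at h
  exact tendsto_of_tendsto_of_tendsto_of_le_of_le hlow tendsto_const_nhds
    (fun j => (hts j).1.le) (fun j => (hts j).2.le)

/-- **Clay (A) from W3ᵐᵗ and NoTypeII THROUGH THE SEQUENCE DOOR** (same statement as the route's `closes`, composed
as W3ᵐᵗ ⇒ sequence door ⇒ `navierStokesRegularity_of_seqNearMaxBulkAlignment_of_noTypeII`): certifies that the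
sequence door sits between the filed crux and the conclusion. [folklore] -/
theorem navierStokesRegularity_of_aprioriMostTimesBulkAlignment_via_seq
    (hW : Summit.NavierStokesRegularity.NavierStokesRegularity.Theses.ScaledTopAlignment.AprioriMostTimesBulkAlignment)
    (hII : Summit.NavierStokesRegularity.NavierStokesRegularity.Theses.ScaledTopAlignment.NoTypeII) :
    _root_.NavierStokesRegularity :=
  navierStokesRegularity_of_seqNearMaxBulkAlignment_of_noTypeII
    (seqNearMaxBulkAlignment_of_aprioriMostTimesBulkAlignment hW) hII

end Summit.NavierStokesRegularity.NavierStokesRegularity.Theorems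

end
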